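import Literature.NumberTheory.EllipticCurves.HeckeOperatorsCoprimeProofs

/-!
# `T_{mn} = T_m T_n` for coprime `m, n` on `S_k(Γ₁(N))`

Companion to `Literature.NumberTheory.EllipticCurves.HeckeOperators` (trunk EllArithM, item C5).
This file **discharges the named fact
`Literature.NumberTheory.EllipticCurves.ModularForms.heckeT_mul_of_coprime_gamma1`** of that file:
`theorem heckeT_mul_of_coprime_gamma1_holds : heckeT_mul_of_coprime_gamma1 N k`, i.e. for all
`N ≥ 1`, all weights `k` and all coprime `m, n ≥ 1`, the double coset operators
`T_m = [Γ₁(N) diag(1,m) Γ₁(N)]` on `S_k(Γ₁(N))` satisfy `T_{mn} = T_m ∘ T_n`.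

It is the `Γ₁(N)`-twin of `HeckeOperatorsCoprimeProofs.lean` (level `Γ₀(N)`,
`heckeT_mul_of_coprime_holds`), whose level-independent parts it reuses.

## Source and proof architecture

G. Shimura, *Introduction to the arithmetic theory of automorphic functions* (1971), Ch. 3. With
`Γ' = Γ₁(N)` (the group (3.3.2) with `𝔥 = {1}`, `t = 1`) and `Δ'` the semigroup (3.3.3) of integer
matrices `(a b; c d)`, `det > 0`, `N ∣ c`, `a ≡ 1 (N)`, the identity
`Γ' diag(1,mn) Γ' = (Γ' diag(1,n) Γ')·(Γ' diag(1,m) Γ')` in the Hecke ring `R(Γ', Δ')` for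
`gcd(m, n) = 1` is contained in Prop. 3.16 (`(ΓαΓ)(ΓβΓ) = ΓαβΓ` when `det α` is prime to `det β`,
level `SL_n(ℤ)`), transported to `Γ'` by Prop. 3.31 for determinants prime to `N`, together with
Prop. 3.32(3) (`Γ'αΓ' = (Γ'ξΓ')(Γ'ηΓ') = (Γ'ηΓ')(Γ'ξΓ')`, `η = diag(1, m)`, `m ∣ N^∞`) and
Thm. 3.34(3)–(4); Prop. 3.38 (`[XY]_k = [X]_k [Y]_k`) turns it into the identity of operators.
(The docstring of the fact cites "Prop. 3.7", which is the special case `Γα = αΓ` of such product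
formulas; the statement itself is the one above.)

As in `HeckeOperatorsCoprimeProofs.lean` we prove directly the coset-level content
(Shimura §3.1, (3.1.1)): if `Γ diag(1,n) Γ = ⊔ᵢ Γ αᵢ` and `Γ diag(1,m) Γ = ⊔ⱼ Γ βⱼ` then
`Γ diag(1,nm) Γ = ⊔ᵢⱼ Γ αᵢ βⱼ` (`gamma1_isDoubleCosetDecomp_mul`), using the tree's
`IsDoubleCosetDecomp.mul`; the double coset formula then identifies both sides of the fact with
`∑ᵢ ∑ⱼ f ∣[k] (αᵢ βⱼ)` (`heckeT_mul_eq_heckeT_mul_heckeT_of_isDoubleCosetDecomp`). The two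
`Γ₁(N)`-specific inputs are:

1. (`H1`, `HeckeTMul.diag_mul_mem_doubleCoset_gamma1`)
   `Γ₁(N) diag(1,n) Γ₁(N) diag(1,m) Γ₁(N) = Γ₁(N) diag(1,nm) Γ₁(N)`: for `γ = (a b; c d) ∈ Γ₀(N)`
   the integer matrices `diag(1,n) γ diag(1,m) = (a, bm; nc, ndm)` and
   `diag(1,nm) γ = (a, b; nmc, nmd)` are both *primitive* (a common divisor of `a, bm, nc` divides
   `bc = u(bm)c + vb(nc)`, `um + vn = 1`, hence `ad - bc = 1`), of determinant `nm`, with lower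
   left entry divisible by `N` and the same upper left entry `a`, hence lie in the same
   `Γ₁(N)`-double coset by the classification of these double cosets by determinant, gcd of the
   entries and `a mod N` (Shimura Prop. 3.32(1); the tree's
   `HeckeTComm.exists_gamma1_mul_mul_gamma1_eq`):
   `diag(1,n) γ diag(1,m) ∈ Γ₁(N) diag(1,nm) γ Γ₁(N)` (`HeckeTMul.exists_gamma1_diag_mul_eq`).
   (At level `Γ₀(N)` the file `HeckeOperatorsCoprimeProofs.lean` only needs, and only gets,
   `Γ₀(N)`-equivalence.)
2. (`H2`, `HeckeTMul.mul_inv_mem_gamma1_of_mul_mul_inv_mem`) multiplicity one: if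
   `Γ₁ a b = Γ₁ a' b'` with `a, a' ∈ Γ₁ diag(1,n) Γ₁`, `b, b' ∈ Γ₁ diag(1,m) Γ₁`, then
   `Γ₁ b = Γ₁ b'`. The integer-matrix core is the tree's
   `HeckeTMul.exists_gamma0_mul_eq_of_isCoprime` (the `2 × 2` form of the uniqueness `M = M'` of
   the intermediate lattice in Shimura's proof of Prop. 3.16): `B = γ' B'` with `γ' ∈ Γ₀(N)`; and
   `γ' ∈ Γ₁(N)` automatically, because `B, B'` have upper left entries `≡ 1` and `B'` has lower
   left entry `≡ 0 (mod N)` (`HeckeTMul.mem_gamma1_of_mul_eq`).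

## Main results (namespace `Literature.NumberTheory.EllipticCurves.ModularForms`)

* `HeckeTMul.exists_gamma1_diag_mul_eq`, `HeckeTMul.diag_mul_mem_doubleCoset_gamma1` (`H1`).
* `HeckeTMul.exists_int_of_mem_doubleCoset_gamma1`: elements of `Γ₁(N) diag(1,D) Γ₁(N)` are
  images of integer matrices `(a b; c d)`, `det = D`, `N ∣ c`, `a ≡ 1 (N)` (Shimura Prop. 3.32(1),
  easy inclusion).
* `HeckeTMul.mul_inv_mem_gamma1_of_mul_mul_inv_mem` (`H2`).
* `gamma1_isDoubleCosetDecomp_mul`: `Γ₁(N) diag(1,mn) Γ₁(N) = ⊔ᵢⱼ Γ₁(N) αᵢ βⱼ`.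
* `heckeT_mul_of_coprime_gamma1_holds` (discharge).

## References

* G. Shimura, *Introduction to the arithmetic theory of automorphic functions*, Publ. Math. Soc.
  Japan 11, Iwanami Shoten / Princeton University Press, 1971 (lit store
  `book:shimura1973-introduction-arithmetic-theory-automorphic-functions`): §3.1 ((3.1.1),
  Prop. 3.2, Prop. 3.3), §3.2 (Prop. 3.16), §3.3 ((3.3.2), (3.3.3), Prop. 3.31, Prop. 3.32,
  Prop. 3.33, Thm. 3.34), §3.4 ((3.4.1), Prop. 3.38).
* F. Diamond, J. Shurman, *A first course in modular forms*, GTM 228, Springer, 2005, §5.1–5.3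
  (Lemma 5.1.2, Def. 5.1.3, Prop. 5.2.4).
-/

noncomputable section

open scoped MatrixGroups ModularForm

open ConjAct Pointwise UpperHalfPlane

namespace Literature.NumberTheory.EllipticCurves.ModularForms

namespace HeckeTMul

open Matrix CongruenceSubgroup Matrix.SpecialLinearGroup

variable (N : ℕ)

/-! ### `H1`: `Γ₁(N) diag(1,n) Γ₁(N) diag(1,m) Γ₁(N) = Γ₁(N) diag(1,nm) Γ₁(N)` -/

/-- The real matrix of `diag(1,n) γ diag(1,m)` for `γ ∈ SL₂(ℤ)` is the cast of
`(a, bm; nc, ndm)`. [folklore] -/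
lemma val_diag_mul_mapGL_mul_diag (m n : ℕ) [NeZero m] [NeZero n] (γ : SL(2, ℤ)) :
    ((diagOneR n * mapGL ℝ γ * diagOneR m : GL (Fin 2) ℝ) : Matrix (Fin 2) (Fin 2) ℝ) =
      (!![γ 0 0, γ 0 1 * m; n * γ 1 0, n * γ 1 1 * m] : Matrix (Fin 2) (Fin 2) ℤ).map
        (Int.castRingHom ℝ) := by
  ext i j
  fin_cases i <;> fin_cases j <;> simp [diagGL, Matrix.mul_apply, Fin.sum_univ_two]

/-- The real matrix of `diag(1,n) diag(1,m)` is the cast of `diag(1, nm)`. [folklore] -/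
lemma val_diagOneR_mul (m n : ℕ) [NeZero m] [NeZero n] :
    ((diagOneR n * diagOneR m : GL (Fin 2) ℝ) : Matrix (Fin 2) (Fin 2) ℝ) =
      (!![1, 0; 0, (n : ℤ) * m] : Matrix (Fin 2) (Fin 2) ℤ).map (Int.castRingHom ℝ) := by
  ext i j
  rw [Matrix.GeneralLinearGroup.coe_mul]
  fin_cases i <;> fin_cases j <;>
    simp [diagGL, Matrix.mul_apply, Fin.sum_univ_two]

/-- **`diag(1,n) γ diag(1,m) ∈ Γ₁(N) diag(1,nm) γ Γ₁(N)` for `γ ∈ Γ₀(N)` and `gcd(m, n) = 1`.**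
For `γ = (a b; c d) ∈ Γ₀(N)` the integer matrices `Y = diag(1,n) γ diag(1,m) = (a, bm; nc, ndm)`
and `X = diag(1,nm) γ = (a, b; nmc, nmd)` have the same determinant `nm`, lower left entries
divisible by `N`, the same upper left entry `a` (prime to `N`), and both are primitive (a common
divisor of `a, bm, nc` divides `bc = u(bm)c + vb(nc)`, `um + vn = 1`, hence `ad - bc = 1`), so
`Y = γ' X δ'` with `γ', δ' ∈ Γ₁(N)` by the classification of the `Γ₁(N)`-double cosets of such
matrices by determinant, gcd of the entries and `a mod N` (Shimura 1971, Prop. 3.32(1);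
`HeckeTComm.exists_gamma1_mul_mul_gamma1_eq`). [cite: Shimura1971, Prop. 3.32(1) and Prop. 3.16] -/
theorem exists_gamma1_diag_mul_eq {m n : ℕ} [NeZero m] [NeZero n] (hmn : m.Coprime n)
    {g : SL(2, ℤ)} (hg : g ∈ Gamma0 N) :
    ∃ γ' δ' : SL(2, ℤ), γ' ∈ Gamma1 N ∧ δ' ∈ Gamma1 N ∧
      diagOneR n * mapGL ℝ g * diagOneR m =
        mapGL ℝ γ' * (diagOneR n * diagOneR m) * (mapGL ℝ g * mapGL ℝ δ') := by
  have h10 : ((g 1 0 : ℤ) : ZMod N) = 0 := Gamma0_mem.mp hg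
  obtain ⟨t, ht⟩ := (ZMod.intCast_zmod_eq_zero_iff_dvd _ N).mp h10
  have hdetg : g 0 0 * g 1 1 - g 0 1 * g 1 0 = 1 := by
    have := g.det_coe; rwa [Matrix.det_fin_two] at this
  have hga : IsCoprime (g 0 0 : ℤ) N := by
    refine ⟨g 1 1, -(g 0 1 * t), ?_⟩
    rw [ht] at hdetg
    linear_combination hdetg
  obtain ⟨u, v, huv⟩ : IsCoprime (m : ℤ) n := Nat.isCoprime_iff_coprime.mpr hmn
  -- the integer matrices
  set X₀ : Matrix (Fin 2) (Fin 2) ℤ := !![1, 0; 0, (n : ℤ) * m] with hX₀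
  set X : Matrix (Fin 2) (Fin 2) ℤ := !![g 0 0, g 0 1; n * m * g 1 0, n * m * g 1 1] with hX
  set Y : Matrix (Fin 2) (Fin 2) ℤ := !![g 0 0, g 0 1 * m; n * g 1 0, n * g 1 1 * m] with hY
  have hXX₀ : X = X₀ * g := by
    ext i j
    fin_cases i <;> fin_cases j <;> simp [hX, hX₀, Matrix.mul_apply, Fin.sum_univ_two]
  have hmn0 : (n : ℤ) * m ≠ 0 :=
    mul_ne_zero (by exact_mod_cast NeZero.ne n) (by exact_mod_cast NeZero.ne m)
  have hXdet : X.det = n * m := by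
    rw [hX, Matrix.det_fin_two_of]; linear_combination (n : ℤ) * m * hdetg
  have hYdet : Y.det = n * m := by
    rw [hY, Matrix.det_fin_two_of]; linear_combination (n : ℤ) * m * hdetg
  -- primitivity of `X` and `Y`
  have hdiv : ∀ f : ℤ, (∀ i j, f ∣ X i j) ↔ (∀ i j, f ∣ Y i j) := by
    intro f
    constructor
    · intro hf i j
      have hf00 : f ∣ g 0 0 := by simpa [hX] using hf 0 0
      have hf01 : f ∣ g 0 1 := by simpa [hX] using hf 0 1
      have h1 : f ∣ 1 := by
        rw [← hdetg]
        exact dvd_sub (dvd_mul_of_dvd_left hf00 _) (dvd_mul_of_dvd_left hf01 _)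
      exact h1.trans (one_dvd _)
    · intro hf i j
      have hf00 : f ∣ g 0 0 := by simpa [hY] using hf 0 0
      have hf01 : f ∣ g 0 1 * m := by simpa [hY] using hf 0 1
      have hf10 : f ∣ n * g 1 0 := by simpa [hY] using hf 1 0
      have hbc : f ∣ g 0 1 * g 1 0 := by
        have : g 0 1 * g 1 0 = (u * g 1 0) * (g 0 1 * m) + (v * g 0 1) * (n * g 1 0) := by
          linear_combination (-(g 0 1 * g 1 0)) * huv
        rw [this]
        exact hf01.linear_comb hf10 _ _
      have h1 : f ∣ 1 := by
        rw [← hdetg]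
        exact dvd_sub (dvd_mul_of_dvd_left hf00 _) hbc
      exact h1.trans (one_dvd _)
  have hXc : (N : ℤ) ∣ X 1 0 := by
    simpa [hX] using dvd_mul_of_dvd_right (⟨t, ht⟩ : (N : ℤ) ∣ g 1 0) ((n : ℤ) * m)
  have hYc : (N : ℤ) ∣ Y 1 0 := by
    simpa [hY] using dvd_mul_of_dvd_right (⟨t, ht⟩ : (N : ℤ) ∣ g 1 0) (n : ℤ)
  have hXa : IsCoprime (X 0 0) N := by simpa [hX] using hga
  have hYa : IsCoprime (Y 0 0) N := by simpa [hY] using hga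
  have ha : ((Y 0 0 : ℤ) : ZMod N) = X 0 0 := by simp [hX, hY]
  obtain ⟨γ', δ', hγ', hδ', heq⟩ := HeckeTComm.exists_gamma1_mul_mul_gamma1_eq N (X := X) (Y := Y)
    (by rw [hXdet]; exact hmn0) (by rw [hXdet, hYdet]) hXc hYc hXa hYa ha hdiv
  refine ⟨γ', δ', hγ', hδ', ?_⟩
  -- the matrix identity in `GL(2, ℝ)`
  refine Units.ext ?_
  rw [val_diag_mul_mapGL_mul_diag, Matrix.GeneralLinearGroup.coe_mul,
    Matrix.GeneralLinearGroup.coe_mul, val_diagOneR_mul, Matrix.GeneralLinearGroup.coe_mul,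
    mapGL_coe_matrix, mapGL_coe_matrix, mapGL_coe_matrix, algebraMap_int_eq, map_apply_coe,
    map_apply_coe, map_apply_coe, RingHom.mapMatrix_apply, RingHom.mapMatrix_apply,
    RingHom.mapMatrix_apply, ← Matrix.map_mul, ← Matrix.map_mul, ← Matrix.map_mul, ← hX₀, ← hY,
    heq, hXX₀]
  simp only [Matrix.mul_assoc]

/-- **`H1` for `Γ₁(N)`**: `diag(1,n) γ diag(1,m) ∈ Γ₁(N) diag(1,n) diag(1,m) Γ₁(N)` for
`γ ∈ Γ₁(N)`, `gcd(m, n) = 1`, i.e. `Γ₁ diag(1,n) Γ₁ diag(1,m) Γ₁ = Γ₁ diag(1,nm) Γ₁`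
(Shimura 1971, Prop. 3.32(1),(3)). [cite: Shimura1971, Prop. 3.32] -/
theorem diag_mul_mem_doubleCoset_gamma1 {m n : ℕ} [NeZero m] [NeZero n] (hmn : m.Coprime n)
    {γ : GL (Fin 2) ℝ} (hγ : γ ∈ (Gamma1 N : Subgroup (GL (Fin 2) ℝ))) :
    diagOneR n * γ * diagOneR m ∈ DoubleCoset.doubleCoset (diagOneR n * diagOneR m)
      ((Gamma1 N : Subgroup (GL (Fin 2) ℝ)) : Set (GL (Fin 2) ℝ))
      (Gamma1 N : Subgroup (GL (Fin 2) ℝ)) := by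
  obtain ⟨g, hg, rfl⟩ := Subgroup.mem_map.mp hγ
  obtain ⟨γ', δ', hγ', hδ', heq⟩ := exists_gamma1_diag_mul_eq N hmn (Gamma1_in_Gamma0 N hg)
  rw [heq]
  exact DoubleCoset.mem_doubleCoset.mpr ⟨mapGL ℝ γ', ⟨γ', hγ', rfl⟩, mapGL ℝ g * mapGL ℝ δ',
    ⟨g * δ', Subgroup.mul_mem _ hg hδ', map_mul _ _ _⟩, rfl⟩

/-! ### Integer matrices behind `Γ₁(N) diag(1,D) Γ₁(N)` -/

/-- Elements of `Γ₁(N)` are images of integer matrices of determinant `1` with `N ∣ c`,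
`a ≡ 1 (mod N)`. [folklore] -/
lemma exists_int_of_mem_gamma1 {x : GL (Fin 2) ℝ} (hx : x ∈ (Gamma1 N : Subgroup (GL (Fin 2) ℝ))) :
    ∃ X : Matrix (Fin 2) (Fin 2) ℤ, (x : Matrix (Fin 2) (Fin 2) ℝ) = X.map (Int.castRingHom ℝ) ∧
      X.det = 1 ∧ (N : ℤ) ∣ X 1 0 ∧ ((X 0 0 : ℤ) : ZMod N) = 1 := by
  obtain ⟨γ, hγ, rfl⟩ := Subgroup.mem_map.mp hx
  obtain ⟨h00, -, h10⟩ := (Gamma1_mem N γ).mp hγ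
  exact ⟨γ, rfl, γ.det_coe, (ZMod.intCast_zmod_eq_zero_iff_dvd _ N).mp h10, h00⟩

/-- `diag(1, m)` is the image of the integer matrix `diag(1, m)`: determinant `m`, `c = 0`,
`a = 1`. [folklore] -/
lemma exists_int_diagOneR (m : ℕ) [NeZero m] :
    ∃ X : Matrix (Fin 2) (Fin 2) ℤ,
      ((diagOneR m : GL (Fin 2) ℝ) : Matrix (Fin 2) (Fin 2) ℝ) = X.map (Int.castRingHom ℝ) ∧
      X.det = m ∧ (N : ℤ) ∣ X 1 0 ∧ ((X 0 0 : ℤ) : ZMod N) = 1 := by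
  refine ⟨!![1, 0; 0, (m : ℤ)], ?_, ?_, by simp, by simp⟩
  · ext i j
    fin_cases i <;> fin_cases j <;> simp [diagGL]
  · rw [Matrix.det_fin_two_of]; ring

variable {N} in
/-- Products: integer matrices with `N ∣ c`, `a ≡ 1 (mod N)` form a semigroup, and determinants
multiply. [folklore] -/
lemma exists_int_mul₁ {D D' : ℤ} {x y : GL (Fin 2) ℝ}
    (hx : ∃ X : Matrix (Fin 2) (Fin 2) ℤ, (x : Matrix (Fin 2) (Fin 2) ℝ) = X.map (Int.castRingHom ℝ) ∧
      X.det = D ∧ (N : ℤ) ∣ X 1 0 ∧ ((X 0 0 : ℤ) : ZMod N) = 1)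
    (hy : ∃ Y : Matrix (Fin 2) (Fin 2) ℤ, (y : Matrix (Fin 2) (Fin 2) ℝ) = Y.map (Int.castRingHom ℝ) ∧
      Y.det = D' ∧ (N : ℤ) ∣ Y 1 0 ∧ ((Y 0 0 : ℤ) : ZMod N) = 1) :
    ∃ Z : Matrix (Fin 2) (Fin 2) ℤ, ((x * y : GL (Fin 2) ℝ) : Matrix (Fin 2) (Fin 2) ℝ) =
      Z.map (Int.castRingHom ℝ) ∧ Z.det = D * D' ∧ (N : ℤ) ∣ Z 1 0 ∧ ((Z 0 0 : ℤ) : ZMod N) = 1 := by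
  obtain ⟨X, hxX, hXd, hXc, hXa⟩ := hx
  obtain ⟨Y, hyY, hYd, hYc, hYa⟩ := hy
  refine ⟨X * Y, ?_, ?_, ?_, ?_⟩
  · rw [Matrix.GeneralLinearGroup.coe_mul, hxX, hyY, Matrix.map_mul]
  · rw [Matrix.det_mul, hXd, hYd]
  · simp only [Matrix.mul_apply, Fin.sum_univ_two]
    exact dvd_add (dvd_mul_of_dvd_left hXc _) (dvd_mul_of_dvd_right hYc _)
  · have hYc' : ((Y 1 0 : ℤ) : ZMod N) = 0 := (ZMod.intCast_zmod_eq_zero_iff_dvd _ N).mpr hYc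
    simp only [Matrix.mul_apply, Fin.sum_univ_two]
    push_cast
    rw [hXa, hYa, hYc', one_mul, mul_zero, add_zero]

/-- **`Γ₁(N) diag(1,m) Γ₁(N)` consists of images of integer matrices of determinant `m` with
`N ∣ c`, `a ≡ 1 (mod N)`**, i.e. `Γ' diag(1,m) Γ' ⊆ {β ∈ Δ' : det β = m}` for `Γ' = Γ₁(N)` and
the semigroup `Δ'` of (3.3.3) with `𝔥 = {1}`, `t = 1` (the easy inclusion of Shimura 1971,
Prop. 3.32(1)); here with the integer matrix `X` and `x = intGL X`. [cite: Shimura1971, Prop. 3.32(1)] -/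
lemma exists_int_of_mem_doubleCoset_gamma1 (m : ℕ) [NeZero m] {x : GL (Fin 2) ℝ}
    (hx : x ∈ DoubleCoset.doubleCoset (diagOneR m)
      ((Gamma1 N : Subgroup (GL (Fin 2) ℝ)) : Set (GL (Fin 2) ℝ)) (Gamma1 N : Subgroup (GL (Fin 2) ℝ))) :
    ∃ X : Matrix (Fin 2) (Fin 2) ℤ, x = intGL X ∧
      X.det = m ∧ (N : ℤ) ∣ X 1 0 ∧ ((X 0 0 : ℤ) : ZMod N) = 1 := by
  obtain ⟨γ, hγ, δ, hδ, rfl⟩ := DoubleCoset.mem_doubleCoset.mp hx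
  obtain ⟨X, hX, hXd, hXc, hXa⟩ := exists_int_mul₁ (exists_int_mul₁ (exists_int_of_mem_gamma1 N hγ)
    (exists_int_diagOneR N m)) (exists_int_of_mem_gamma1 N hδ)
  rw [one_mul, mul_one] at hXd
  have hXdet : X.det ≠ 0 := by rw [hXd]; exact_mod_cast NeZero.ne m
  exact ⟨X, Units.ext (by rw [hX, coe_intGL hXdet]), hXd, hXc, hXa⟩

/-! ### `H2`: multiplicity one -/

/-- **From `Γ₀(N)` to `Γ₁(N)`.** If `γ' ∈ Γ₀(N)` and `γ' B' = B` for integer matrices `B, B'` with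
upper left entries `≡ 1 (mod N)` and `N ∣ B'₁₀`, then `γ' ∈ Γ₁(N)`: the upper left entry of
`γ' B' = B` gives `γ'₀₀ ≡ 1`, and `det γ' = 1` with `γ'₁₀ ≡ 0` gives `γ'₁₁ ≡ 1`. [folklore] -/
lemma mem_gamma1_of_mul_eq {γ' : SL(2, ℤ)} (hγ' : γ' ∈ Gamma0 N) {B B' : Matrix (Fin 2) (Fin 2) ℤ}
    (hBa : ((B 0 0 : ℤ) : ZMod N) = 1) (hB'a : ((B' 0 0 : ℤ) : ZMod N) = 1)
    (hB'c : (N : ℤ) ∣ B' 1 0) (h : (γ' : Matrix (Fin 2) (Fin 2) ℤ) * B' = B) :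
    γ' ∈ Gamma1 N := by
  have h10 : ((γ' 1 0 : ℤ) : ZMod N) = 0 := Gamma0_mem.mp hγ'
  have hB'c' : ((B' 1 0 : ℤ) : ZMod N) = 0 := (ZMod.intCast_zmod_eq_zero_iff_dvd _ N).mpr hB'c
  have h00 : ((γ' 0 0 : ℤ) : ZMod N) = 1 := by
    have := congrArg (fun M : Matrix (Fin 2) (Fin 2) ℤ ↦ ((M 0 0 : ℤ) : ZMod N)) h
    simp only [Matrix.mul_apply, Fin.sum_univ_two] at this
    push_cast at this
    rw [hB'a, hB'c', hBa, mul_one, mul_zero, add_zero] at this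
    exact this
  have h11 : ((γ' 1 1 : ℤ) : ZMod N) = 1 := by
    have hdet := γ'.det_coe
    rw [Matrix.det_fin_two] at hdet
    have := congrArg (Int.cast : ℤ → ZMod N) hdet
    push_cast at this
    rw [h00, h10, one_mul, mul_zero, sub_zero] at this
    exact this
  exact (Gamma1_mem N γ').mpr ⟨h00, h11, h10⟩

/-- **`H2` for `Γ₁(N)`: distinct pairs give distinct cosets.** If `a, a' ∈ Γ₁(N) diag(1,n) Γ₁(N)`,
`b, b' ∈ Γ₁(N) diag(1,m) Γ₁(N)` with `gcd(m, n) = 1` and `Γ₁(N) a b = Γ₁(N) a' b'`, then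
`Γ₁(N) b = Γ₁(N) b'`. The integer-matrix core is `HeckeTMul.exists_gamma0_mul_eq_of_isCoprime`
(`B = γ' B'` with `γ' ∈ Γ₀(N)`; the `2 × 2` form of the uniqueness `M = M'` of the intermediate
lattice in Shimura 1971, proof of Prop. 3.16), and `γ' ∈ Γ₁(N)` by `mem_gamma1_of_mul_eq`.
[cite: Shimura1971, Prop. 3.16 (proof)] -/
theorem mul_inv_mem_gamma1_of_mul_mul_inv_mem {m n : ℕ} [NeZero m] [NeZero n]
    (hmn : m.Coprime n) {a b a' b' : GL (Fin 2) ℝ}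
    (ha : a ∈ DoubleCoset.doubleCoset (diagOneR n)
      ((Gamma1 N : Subgroup (GL (Fin 2) ℝ)) : Set (GL (Fin 2) ℝ))
      (Gamma1 N : Subgroup (GL (Fin 2) ℝ)))
    (hb : b ∈ DoubleCoset.doubleCoset (diagOneR m)
      ((Gamma1 N : Subgroup (GL (Fin 2) ℝ)) : Set (GL (Fin 2) ℝ))
      (Gamma1 N : Subgroup (GL (Fin 2) ℝ)))
    (ha' : a' ∈ DoubleCoset.doubleCoset (diagOneR n)
      ((Gamma1 N : Subgroup (GL (Fin 2) ℝ)) : Set (GL (Fin 2) ℝ))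
      (Gamma1 N : Subgroup (GL (Fin 2) ℝ)))
    (hb' : b' ∈ DoubleCoset.doubleCoset (diagOneR m)
      ((Gamma1 N : Subgroup (GL (Fin 2) ℝ)) : Set (GL (Fin 2) ℝ))
      (Gamma1 N : Subgroup (GL (Fin 2) ℝ)))
    (h : a * b * (a' * b')⁻¹ ∈ (Gamma1 N : Subgroup (GL (Fin 2) ℝ))) :
    b * b'⁻¹ ∈ (Gamma1 N : Subgroup (GL (Fin 2) ℝ)) := by
  obtain ⟨A, rfl, hAd, hAc, -⟩ := exists_int_of_mem_doubleCoset_gamma1 N n ha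
  obtain ⟨A', rfl, hA'd, hA'c, -⟩ := exists_int_of_mem_doubleCoset_gamma1 N n ha'
  obtain ⟨B, rfl, hBd, hBc, hBa⟩ := exists_int_of_mem_doubleCoset_gamma1 N m hb
  obtain ⟨B', rfl, hB'd, hB'c, hB'a⟩ := exists_int_of_mem_doubleCoset_gamma1 N m hb'
  have hm0 : (m : ℤ) ≠ 0 := by exact_mod_cast NeZero.ne m
  have hn0 : (n : ℤ) ≠ 0 := by exact_mod_cast NeZero.ne n
  have hAdet : A.det ≠ 0 := by rw [hAd]; exact hn0
  have hA'det : A'.det ≠ 0 := by rw [hA'd]; exact hn0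
  have hBdet : B.det ≠ 0 := by rw [hBd]; exact hm0
  have hB'det : B'.det ≠ 0 := by rw [hB'd]; exact hm0
  have hABdet : (A * B).det ≠ 0 := by rw [Matrix.det_mul]; exact mul_ne_zero hAdet hBdet
  have hA'B'det : (A' * B').det ≠ 0 := by rw [Matrix.det_mul]; exact mul_ne_zero hA'det hB'det
  -- down to `Γ₀(N)`, then to integer matrices
  have h0 : intGL A * intGL B * (intGL A' * intGL B')⁻¹ ∈ (Gamma0 N : Subgroup (GL (Fin 2) ℝ)) :=
    Subgroup.map_mono (Gamma1_in_Gamma0 N) h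
  rw [← intGL_mul hAdet hBdet, ← intGL_mul hA'det hB'det,
    intGL_mul_inv_mem_gamma0_iff hABdet hA'B'det] at h0
  obtain ⟨γ, hγ, hγeq⟩ := h0
  have hγc : (N : ℤ) ∣ (γ : Matrix (Fin 2) (Fin 2) ℤ) 1 0 := by
    simpa [Gamma0_mem, ZMod.intCast_zmod_eq_zero_iff_dvd] using hγ
  obtain ⟨γ', hγ'0, hγ'eq⟩ := exists_gamma0_mul_eq_of_isCoprime hm0
    (Nat.isCoprime_iff_coprime.mpr hmn) hAd hAc hA'c hBd hB'd hBc hB'c hγc hγeq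
  have hγ'1 : γ' ∈ Gamma1 N := mem_gamma1_of_mul_eq N hγ'0 hBa hB'a hB'c hγ'eq
  -- `B B'⁻¹ = γ'`
  have : intGL B * (intGL B')⁻¹ = mapGL ℝ γ' := by
    rw [mul_inv_eq_iff_eq_mul, mapGL_eq_intGL, ← intGL_mul (by simp) hB'det, hγ'eq]
  rw [this]
  exact ⟨γ', hγ'1, rfl⟩

end HeckeTMul

/-! ### The decomposition of `Γ₁(N) diag(1,mn) Γ₁(N)` and the discharge -/

section Discharge

open CongruenceSubgroup

/-- **`Γ₁(N) diag(1,n) diag(1,m) Γ₁(N) = ⊔_{i,j} Γ₁(N) αᵢ βⱼ`** (and `diag(1,n) diag(1,m) =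
diag(1, mn)`, `diagOneR_mul_diagOneR`) for coprime `m, n`, whenever
`Γ₁(N) diag(1,n) Γ₁(N) = ⊔ᵢ Γ₁(N) αᵢ` and `Γ₁(N) diag(1,m) Γ₁(N) = ⊔ⱼ Γ₁(N) βⱼ`: the coset-level
content of `(Γ' δₙ Γ')(Γ' δₘ Γ') = Γ' δₙδₘ Γ'` in `R(Γ₁(N), Δ')` (Shimura 1971, Prop. 3.16 with
Prop. 3.31, Prop. 3.32(3) and Thm. 3.34(3)–(4)), from `IsDoubleCosetDecomp.mul` with `H1`
(`HeckeTMul.diag_mul_mem_doubleCoset_gamma1`) and `H2`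
(`HeckeTMul.mul_inv_mem_gamma1_of_mul_mul_inv_mem`).
[cite: Shimura1971, Prop. 3.16, Prop. 3.32(3) and Thm. 3.34(3)-(4)] -/
theorem gamma1_isDoubleCosetDecomp_mul (N : ℕ) {m n : ℕ} [NeZero m] [NeZero n]
    (hmn : m.Coprime n) {ι κ : Type*} {α : ι → GL (Fin 2) ℝ} {β : κ → GL (Fin 2) ℝ}
    (hα : IsDoubleCosetDecomp (Gamma1 N : Subgroup (GL (Fin 2) ℝ)) (Gamma1 N) (diagOneR n) α)
    (hβ : IsDoubleCosetDecomp (Gamma1 N : Subgroup (GL (Fin 2) ℝ)) (Gamma1 N) (diagOneR m) β) :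
    IsDoubleCosetDecomp (Gamma1 N : Subgroup (GL (Fin 2) ℝ)) (Gamma1 N) (diagOneR n * diagOneR m)
      (fun ij : ι × κ ↦ α ij.1 * β ij.2) := by
  refine hα.mul hβ (fun i j ↦ ?_) (fun i j i' j' hij ↦ ?_)
  · obtain ⟨u, hu, v, hv, hαi⟩ := DoubleCoset.mem_doubleCoset.mp (hα.mem i)
    obtain ⟨u', hu', v', hv', hβj⟩ := DoubleCoset.mem_doubleCoset.mp (hβ.mem j)
    have key := HeckeTMul.diag_mul_mem_doubleCoset_gamma1 N hmn (Subgroup.mul_mem _ hv hu')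
    have := IsDoubleCosetDecomp.mul_mem_doubleCoset
      (IsDoubleCosetDecomp.mem_doubleCoset_mul hu key) hv'
    rw [hαi, hβj]
    convert this using 1
    simp only [mul_assoc]
  · exact HeckeTMul.mul_inv_mem_gamma1_of_mul_mul_inv_mem N hmn (hα.mem i) (hβ.mem j)
      (hα.mem i') (hβ.mem j') hij

variable (N : ℕ) [NeZero N] (k : ℤ)

/-- **Discharge of the named fact `heckeT_mul_of_coprime_gamma1`**: for every `N ≥ 1`, every
weight `k` and all coprime `m, n ≥ 1`, `[Γ₁(N) diag(1,mn) Γ₁(N)] = [Γ₁(N) diag(1,m) Γ₁(N)] ∘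
[Γ₁(N) diag(1,n) Γ₁(N)]` on `S_k(Γ₁(N))`. This is the identity
`Γ' diag(1,mn) Γ' = (Γ' diag(1,n) Γ')·(Γ' diag(1,m) Γ')` in the Hecke ring `R(Γ', Δ')` of
`Γ' = Γ₁(N)` (Shimura 1971: Prop. 3.16 for determinants prime to each other at level `SL₂(ℤ)`,
Prop. 3.31 and Prop. 3.32(3), Thm. 3.34(3)–(4) for `Γ'`), made to act on cusp forms by (3.4.1) and
Prop. 3.38 (`[XY]_k = [X]_k [Y]_k`): both sides send `f` to `∑ᵢ ∑ⱼ f ∣[k] (αᵢ βⱼ)`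
(`gamma1_isDoubleCosetDecomp_mul` and `heckeT_mul_eq_heckeT_mul_heckeT_of_isDoubleCosetDecomp`).
(The fact's docstring cites Prop. 3.7, the special case `Γα = αΓ` of such product formulas; for
`m, n` prime cf. Diamond–Shurman Prop. 5.2.4 and (5.10), `T_{mn} = T_m T_n`.)
[cite: Shimura1971, Prop. 3.16, Prop. 3.32(3), Thm. 3.34(3)-(4) and Prop. 3.38] -/
theorem heckeT_mul_of_coprime_gamma1_holds : heckeT_mul_of_coprime_gamma1 N k := by
  intro m n _ _ hmn
  obtain ⟨a, α, hα⟩ := exists_isDoubleCosetDecomp (Gamma1 N : Subgroup (GL (Fin 2) ℝ)) (Gamma1 N)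
    (diagOneR n)
  obtain ⟨b, β, hβ⟩ := exists_isDoubleCosetDecomp (Gamma1 N : Subgroup (GL (Fin 2) ℝ)) (Gamma1 N)
    (diagOneR m)
  have hαβ := gamma1_isDoubleCosetDecomp_mul N hmn hα hβ
  rw [diagOneR_mul_diagOneR m n] at hαβ
  exact heckeT_mul_eq_heckeT_mul_heckeT_of_isDoubleCosetDecomp _ k m n hα hβ hαβ

end Discharge

end Literature.NumberTheory.EllipticCurves.ModularForms

end
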